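import Summits.QuantumFields.YangMills.Theorems.NPointIsotropy.Negative.NPointRegularJunk
import Summits.QuantumFields.YangMills.Theorems.MirrorModularBoostsCurvatureBoostCovarianceDominatedTieLimit
import Summits.QuantumFields.YangMills.Theorems.MirrorModularBoostsCurvatureBoostCovarianceRegularOfDominated
import Summits.QuantumFields.YangMills.Theorems.PencilRigidityNPointIsotropyDegreeOneTie
import HarnessLib

/-!
# `SoftKernelBoostCovariance`, Step 0 from tempered tied lattice approximants — stub `stub_stepZeroOfLattice`

Line `Sketch` of crux `MirrorModularBoosts.SoftKernelBoostCovariance` (stmt-QuantumFields-14999;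
route-QuantumFields-MirrorModularBoosts), skeleton v3.7, registered stub `stub_stepZeroOfLattice`: the POINTWISE,
model-blind glue of Step 0 (`NPointRegular S₁`: every `n`-point function restricted to the off-diagonal test functions
`⁰𝒮` is integration against a function), through which the skeleton proves `stub_tieRegularity` from the shared
Yang–Mills lattice residual `stub_temperedLatticeApproximants`.

Statement (`stub_stepZeroOfLattice`, registered signature verbatim).  Let `a_k → 0⁺` be lattice spacings and `L_k`
half-sides with `a_k L_k → ∞`, and `S₁` a one-species Schwinger family on `ℝ⁴` with `𝔖₀ ≡ 1` (`IsNormalized`).  Suppose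
that in every degree `n ≥ 1` there are lattice densities `D_k : (ℤ⁴)ⁿ → ℝ`, TEMPERED at injective multi-sites of the box
for `k ≥ k₀` — `|D_k x| ≤ C (1 + ‖a_k x‖)^N (1 + Σ_i Σ_{j ≠ i} ‖a_k xᵢ - a_k xⱼ‖⁻¹)^N` — and TIED to `S₁ n`: the Riemann
sums `(a_k⁴)ⁿ Σ_{x ∈ boxⁿ} ∏ᵢ fᵢ(a_k xᵢ) D_k x` converge to `S₁ n F` for every off-diagonal real product tensor
`F = ⊗ᵢ fᵢ`.  Then `NPointRegular S₁`.

Proof (the parent skeleton's reshape-8 derivation, `Cruxes/CurvatureBoostCovariance/Lines/boosts_inherit_mirrors.lean`,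
`residual_zero` + the body of `stub_tieRegularity`, copied and adapted).
* Degree `0`: the LANDED `NPointIsotropy.ComplexRotationBandlimit.residual_zero`
  (`Theorems/PencilRigidityNPointIsotropyDegreeOneTie.lean`, crux 11686): Lebesgue measure on `Fin 0 → ℝ⁴` is the Dirac
  mass at the empty configuration, so `W₀ ≡ 1` represents `𝔖₀ F = F default` (E0).
* Degree `n ≥ 1`: read the tempered bound against the continuum weight
  `w y = C (1 + ‖y‖)^N (1 + Σ_i Σ_{j ≠ i} ‖yᵢ - yⱼ‖⁻¹)^N` (measurable, nonnegative as `C > 0`, continuous off the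
  coincidence locus `A = {∃ i ≠ j, yᵢ = yⱼ}`); the LANDED `BoostsInheritMirrors.stub_dominatedTieLimit` (p108509) turns the
  tie into the domination `‖S₁ n F‖ ≤ ∫ ‖F‖ w` on `⁰𝒮`, and the LANDED `BoostsInheritMirrors.stub_regular_of_dominated`
  (p109000) turns domination into a representing function.

References: K. Osterwalder, R. Schrader, Comm. Math. Phys. 31 (1973) §2–3 and 42 (1975) §2 (`⁰𝒮`, E0, temperedness of
lattice approximants); J. Glimm, A. Jaffe, Quantum Physics (1987) §9.5–9.6 (lattice approximation). [folklore]
-/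

noncomputable section

namespace Summit.QuantumFields.YangMills.Theorems.SoftKernelBoostCovariance.Sketch

open scoped BigOperators SchwartzMap
open MeasureTheory Filter Topology
open Literature.MathematicalPhysics.QuantumLattice Literature.MathematicalPhysics.AQFT
open Summit.QuantumFields.YangMills.Theorems.NPointIsotropy.Negative (E4 NPointRegular)
open Summit.QuantumFields.YangMills.Theorems.NPointIsotropy.ComplexRotationBandlimit (residual_zero)
open Summit.QuantumFields.YangMills.Theorems.CurvatureBoostCovariance.BoostsInheritMirrors
  (stub_dominatedTieLimit stub_regular_of_dominated)

/-- **Stub `stub_stepZeroOfLattice` — Step 0 from tempered tied lattice approximants (model-blind glue, registered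
signature verbatim).**  Normalisation (`𝔖₀ ≡ 1`) and, in every degree `n ≥ 1`, lattice densities `D_k` tempered at
injective multi-sites (`|D_k x| ≤ C (1 + ‖a_k x‖)^N (1 + Σ_i Σ_{j ≠ i} ‖a_k xᵢ - a_k xⱼ‖⁻¹)^N`, `k ≥ k₀`) whose Riemann
sums converge to `S₁ n` on off-diagonal real product tensors, imply `NPointRegular S₁`.  Degree `0`: the
landed `ComplexRotationBandlimit.residual_zero` (E0); degree `n ≥ 1`: the continuum weight
`w y = C (1 + ‖y‖)^N (1 + Σ_i Σ_{j ≠ i} ‖yᵢ - yⱼ‖⁻¹)^N` fed to the landed `stub_dominatedTieLimit` (domination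
`‖S₁ n F‖ ≤ ∫ ‖F‖ w` on `⁰𝒮`) and `stub_regular_of_dominated` (representing function). -/
theorem stub_stepZeroOfLattice :
    open Literature.MathematicalPhysics.QuantumLattice Literature.MathematicalPhysics.AQFT
      Literature.Probability.LatticeModels
      Summit.QuantumFields.YangMills.Theorems.NPointIsotropy.Negative in
    ∀ (a : ℕ → ℝ) (L : ℕ → ℕ) (S₁ : SchwingerFamily E4),
      (∀ k, 0 < a k) → Filter.Tendsto a Filter.atTop (nhds 0) →
      Filter.Tendsto (fun k => a k * L k) Filter.atTop Filter.atTop →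
      S₁.toLabelled.IsNormalized →
      (∀ n : ℕ, 0 < n → ∃ (D : ℕ → (Fin n → Site 4) → ℝ) (C : ℝ) (N k₀ : ℕ), 0 < C ∧
          (∀ k : ℕ, k₀ ≤ k → ∀ x : Fin n → Site 4, (∀ i, x i ∈ box 4 (L k)) → Function.Injective x →
            |D k x| ≤ C * (1 + ‖fun i => a k • siteToE (x i)‖) ^ N *
              (1 + ∑ i, ∑ j ∈ Finset.univ.erase i, ‖a k • siteToE (x i) - a k • siteToE (x j)‖⁻¹) ^ N) ∧
          ∀ (f : Fin n → SchwartzMap E4 ℝ) (F : SchwartzMap (Fin n → E4) ℂ),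
            IsTensorOf F (fun i => ofRealTest (f i)) → IsOffDiagonal F →
            Filter.Tendsto (fun k => (((a k ^ 4) ^ n *
              ∑ x ∈ Fintype.piFinset (fun _ : Fin n => box 4 (L k)),
                (∏ i, f i (a k • siteToE (x i))) * D k x : ℝ) : ℂ)) Filter.atTop (nhds (S₁ n F))) →
      NPointRegular S₁ := by
  intro a L S₁ ha_pos ha_tendsto haL h0 happrox n
  rcases Nat.eq_zero_or_pos n with rfl | hn
  · exact residual_zero S₁ h0
  obtain ⟨D, C, N, k₀, hCpos, hbound, htie⟩ := happrox n hn
  -- the tempered weight, read on continuum configurations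
  have hcont : ContinuousOn (fun y : Fin n → E4 => C * (1 + ‖y‖) ^ N *
      (1 + ∑ i, ∑ j ∈ Finset.univ.erase i, ‖y i - y j‖⁻¹) ^ N) (coincidenceLocus n E4)ᶜ := by
    refine (continuousOn_const.mul ((continuousOn_const.add continuous_norm.continuousOn).pow N)).mul
      ((continuousOn_const.add (continuousOn_finsetSum _ fun i _ =>
        continuousOn_finsetSum _ fun j hj => ?_)).pow N)
    have hne : ∀ y ∈ (coincidenceLocus n E4)ᶜ, ‖y i - y j‖ ≠ 0 := fun y hy h =>
      hy ⟨i, j, (Finset.ne_of_mem_erase hj).symm, sub_eq_zero.1 (norm_eq_zero.1 h)⟩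
    exact ContinuousOn.inv₀ (by fun_prop) hne
  have hmeas : Measurable (fun y : Fin n → E4 => C * (1 + ‖y‖) ^ N *
      (1 + ∑ i, ∑ j ∈ Finset.univ.erase i, ‖y i - y j‖⁻¹) ^ N) := by
    fun_prop
  have hnn : ∀ y : Fin n → E4, 0 ≤ C * (1 + ‖y‖) ^ N *
      (1 + ∑ i, ∑ j ∈ Finset.univ.erase i, ‖y i - y j‖⁻¹) ^ N := fun y =>
    mul_nonneg (mul_nonneg hCpos.le (by positivity)) (by positivity)
  -- domination on `⁰𝒮` (landed Stub 1b) and the representing function (landed Stub 1c)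
  exact stub_regular_of_dominated n (S₁ n) _ C N hmeas hnn (fun y _ => le_rfl)
    (stub_dominatedTieLimit n hn (S₁ n) a L D _ C N k₀ ha_pos ha_tendsto haL
      hmeas hcont hnn (fun y _ => le_rfl) hbound htie)

end Summit.QuantumFields.YangMills.Theorems.SoftKernelBoostCovariance.Sketch

end
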